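import Summits.ResolutionOfSingularities.ResolutionOfSingularities.Theses.IndSmooth
import Literature.AlgebraicGeometry.Resolution.ArithmeticalThreefolds
import HarnessLib

/-!
# An injective local regular chart is the local ring of a model
# (crux `IndSmooth.SmoothToUniformizing`, stmt-ResolutionOfSingularities-16088, line `birth`,
# skeleton v5, stub `stub_modelOfInjectiveChart`)

Route `ResolutionOfSingularities/IndSmooth`, crux #3 `SmoothToUniformizing`. A **local regular
chart** of `R ⊆ O ⊆ K` (finitely generated `k`-subalgebra `R` of a valuation ring `O` of the field
`K`) is a regular local `k`-algebra `L`, essentially of finite type, with `k`-algebra maps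
`ψ : R → L`, `χ : L → K` such that `χ(L) ⊆ O`, `χ⁻¹(𝔪_O) = 𝔪_L` and `χ ∘ ψ` is the inclusion.

This file proves the INJECTIVE exit of the dichotomy of the line `birth`: if `χ` is injective
(and `Frac R = K`), then `L` is the local ring of a MODEL of `K` inside `O` through `R`: there is a
finitely generated `A` with `R ≤ A ⊆ O`, `Frac A = K`, and `A` regular at the centre `𝔪_O ∩ A`.

Proof. Write `L` as the localization of a finitely generated `k`-subalgebra `S ⊆ L` at the
elements of `S` which are units of `L` (`Algebra.EssFiniteType`), enlarging `S` so that
`ψ(R) ⊆ S` (the localization property is monotone in `S`). Put `A := χ(S) ≅ S` (injectivity).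
Then `A` is finitely generated, `R = χ(ψ(R)) ≤ A ⊆ O`, `Frac A = K` since `Frac R = K`, and under
`S ≅ A` the centre `𝔪_O ∩ A` corresponds to `𝔪_L ∩ S` (this is `χ⁻¹(𝔪_O) = 𝔪_L`), whose
complement in `S` is exactly `S ∩ Lˣ`; so `A` localized at the centre is `≅ L`, a regular local
ring.

References: U. Görtz, T. Wedhorn, *Algebraic Geometry I*, Lemma 6.26 (spreading out a local ring
essentially of finite type to an affine model).
-/

noncomputable section

-- single-problem summit: the doubled namespace component `ResolutionOfSingularities` is forced
set_option linter.dupNamespace false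

open Literature.AlgebraicGeometry.Resolution (isFractionRing_of_le)
open IsLocalRing

namespace Summit.ResolutionOfSingularities.ResolutionOfSingularities.Theorems.IndSmoothBirth

section LocalizingSubalgebra

variable (k : Type*) {L : Type*} [CommRing k] [CommRing L] [Algebra k L]

/-- In a `k`-algebra `L` essentially of finite type, every finitely generated subalgebra `S₀` is
contained in a finitely generated subalgebra `S` of which `L` is the localization at `S ∩ Lˣ`:
every element of `L` lands in `S` after multiplication by a unit of `L` lying in `S`. [folklore] -/
theorem exists_fg_localizing_subalgebra [Algebra.EssFiniteType k L] (S₀ : Subalgebra k L)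
    (h₀ : S₀.FG) :
    ∃ S : Subalgebra k L, S₀ ≤ S ∧ S.FG ∧ ∀ s : L, ∃ t ∈ S, IsUnit t ∧ s * t ∈ S := by
  obtain ⟨σ, hσ⟩ := (Algebra.essFiniteType_iff k L).mp inferInstance
  refine ⟨Algebra.adjoin k (σ : Set L) ⊔ S₀, le_sup_right,
    (Subalgebra.fg_adjoin_finset σ).sup h₀, fun s => ?_⟩
  obtain ⟨t, ht, htu, hst⟩ := hσ s
  exact ⟨t, Algebra.mem_sup_left ht, htu, Algebra.mem_sup_left hst⟩

end LocalizingSubalgebra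

section Chart

variable {k K : Type} [Field k] [Field K] [Algebra k K]

/-- **The image of a localizing subalgebra under an injective local chart is regular at the
centre.** Let `L` be a regular local `k`-algebra, `S ⊆ L` a subalgebra such that every element of
`L` lies in `S` up to a unit of `L` belonging to `S`, and `χ : L → K` an injective `k`-algebra map
with `χ⁻¹(𝔪_O) = 𝔪_L` for the valuation ring `O` of `K`, and `χ(S) ⊆ O`. Then `A := χ(S) ≅ S`,
the centre `𝔪_O ∩ A` corresponds to `𝔪_L ∩ S`, and `A` localized at the centre is `≅ L`
(`L = S_{𝔪_L ∩ S}`), hence a regular local ring. [cite: GortzWedhorn2020, Lemma 6.26] -/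
theorem isRegularLocalRing_centre_map_of_injective (O : ValuationSubring K) (L : Type)
    [CommRing L] [IsRegularLocalRing L] [Algebra k L] (S : Subalgebra k L)
    (hS : ∀ s : L, ∃ t ∈ S, IsUnit t ∧ s * t ∈ S) (χ : L →ₐ[k] K)
    (hinj : Function.Injective χ) (hloc : ∀ x : L, x ∈ maximalIdeal L ↔ O.valuation (χ x) < 1)
    (hAO : (S.map χ).toSubring ≤ O.toSubring) :
    IsRegularLocalRing (Localization.AtPrime
      (Ideal.comap (Subring.inclusion hAO) (IsLocalRing.maximalIdeal O))) := by
  -- `e : S ≃ A := χ(S)` (injectivity of `χ`)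
  let e : S ≃ₐ[k] (S.map χ) := Subalgebra.equivMapOfInjective S χ hinj
  have he : ∀ s : S, ((e s : S.map χ) : K) = χ s := fun s => rfl
  have he' : ∀ a : S.map χ, χ ((e.symm a : S) : L) = (a : K) := fun a => by
    rw [← he, e.apply_symm_apply]
  -- the centre `𝔞 = 𝔪_O ∩ A` corresponds to `𝔪_L ∩ S` under `e` (as `χ⁻¹(𝔪_O) = 𝔪_L`)
  have hcentre : ∀ a : S.map χ,
      a ∈ (Ideal.comap (Subring.inclusion hAO) (IsLocalRing.maximalIdeal O) : Ideal (S.map χ)) ↔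
        ((e.symm a : S) : L) ∈ maximalIdeal L := fun a => by
    rw [hloc, he', Ideal.mem_comap, ValuationSubring.valuation_lt_one_iff]
    rfl
  set 𝔞 : Ideal (S.map χ) := Ideal.comap (Subring.inclusion hAO) (IsLocalRing.maximalIdeal O)
  -- `L` is an `A`-algebra through `e.symm : A ≃ S ⊆ L`, and as such it is `A` localized at `𝔞`:
  -- the complement of `𝔞` is carried by `e.symm` onto `S ∩ Lˣ`, and `L = S · (S ∩ Lˣ)⁻¹`
  letI : Algebra (S.map χ) L := (S.val.comp (e.symm : (S.map χ) →ₐ[k] S)).toRingHom.toAlgebra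
  have halg : ∀ a : S.map χ, algebraMap (S.map χ) L a = ((e.symm a : S) : L) := fun a => rfl
  haveI : IsLocalization.AtPrime L 𝔞 := by
    refine (isLocalization_iff _ _).mpr ⟨?_, ?_, ?_⟩
    · rintro ⟨y, hy⟩
      rw [halg]
      exact IsLocalRing.notMem_maximalIdeal.mp
        ((hcentre y).not.mp (Ideal.mem_primeCompl_iff.mp hy))
    · intro z
      obtain ⟨t, ht, htu, hzt⟩ := hS z
      have ht𝔞 : e ⟨t, ht⟩ ∈ 𝔞.primeCompl := by
        rw [Ideal.mem_primeCompl_iff, hcentre, e.symm_apply_apply]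
        exact IsLocalRing.notMem_maximalIdeal.mpr htu
      refine ⟨(e ⟨z * t, hzt⟩, ⟨e ⟨t, ht⟩, ht𝔞⟩), ?_⟩
      rw [halg, halg]
      change z * ((e.symm (e ⟨t, ht⟩) : S) : L) = ((e.symm (e ⟨z * t, hzt⟩) : S) : L)
      rw [e.symm_apply_apply, e.symm_apply_apply]
    · intro x y hxy
      rw [halg, halg] at hxy
      exact ⟨1, by rw [e.symm.injective (Subtype.ext hxy)]⟩
  -- hence `A_𝔞 ≅ L` is regular
  exact IsRegularLocalRing.of_ringEquiv (Localization.algEquiv 𝔞.primeCompl L).symm.toRingEquiv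

end Chart

/-- **Stub `stub_modelOfInjectiveChart` of the line `birth` (skeleton v5): an injective local
regular chart is the local ring of a model.** Let `R ⊆ O ⊆ K` with `R` finitely generated over
`k` and `Frac R = K`, and let `(L, ψ, χ)` be a local regular chart of `R` (`L` regular local,
essentially of finite type over `k`, `χ(L) ⊆ O`, `χ⁻¹(𝔪_O) = 𝔪_L`, `χ ∘ ψ =` the inclusion) with
`χ` INJECTIVE. Then there is a finitely generated `A` with `R ≤ A ⊆ O`, `Frac A = K`, regular at
the centre `𝔪_O ∩ A`. Proof: `L` is the localization of a finitely generated `S ∋ ψ(R)` at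
`S ∩ Lˣ` (`exists_fg_localizing_subalgebra`); take `A := χ(S)`: it contains `R = χ(ψ(R))`, is
finitely generated, has `Frac A = K` (`isFractionRing_of_le`), and `A` localized at the centre is
`≅ L` (`isRegularLocalRing_centre_map_of_injective`). [cite: GortzWedhorn2020, Lemma 6.26] -/
theorem stub_modelOfInjectiveChart (k K : Type) [Field k] [Field K] [Algebra k K]
    (O : ValuationSubring K) (R : Subalgebra k K) (hR : R.FG) (hRO : R.toSubring ≤ O.toSubring)
    (hRfr : IsFractionRing R K) (L : Type) [CommRing L] [IsRegularLocalRing L] [Algebra k L]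
    [Algebra.EssFiniteType k L] (ψ : R →ₐ[k] L) (χ : L →ₐ[k] K) (hχO : ∀ x : L, χ x ∈ O)
    (hloc : ∀ x : L, x ∈ maximalIdeal L ↔ O.valuation (χ x) < 1)
    (hψχ : ∀ r : R, χ (ψ r) = (r : K)) (hinj : Function.Injective χ) :
    ∃ (A : Subalgebra k K) (h : A.toSubring ≤ O.toSubring), R ≤ A ∧ A.FG ∧ IsFractionRing A K ∧
      IsRegularLocalRing (Localization.AtPrime
        (Ideal.comap (Subring.inclusion h) (IsLocalRing.maximalIdeal O))) := by
  -- (`hRO : R ⊆ O` is implied by the chart, `R = χ(ψ(R)) ⊆ χ(L) ⊆ O`, and is not used)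
  have _ := hRO
  -- a finitely generated `S ⊆ L` containing `ψ(R)` with `L = S · (S ∩ Lˣ)⁻¹`
  have hψfg : ψ.range.FG := by
    rw [← Algebra.map_top]
    exact Subalgebra.FG.map _ ((Subalgebra.fg_top R).mpr hR)
  obtain ⟨S, hψS, hSfg, hS⟩ := exists_fg_localizing_subalgebra k ψ.range hψfg
  -- the model `A := χ(S)`
  have hAO : (S.map χ).toSubring ≤ O.toSubring := by
    intro x hx
    obtain ⟨s, -, rfl⟩ := Subalgebra.mem_map.mp (Subalgebra.mem_toSubring.mp hx)
    exact hχO s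
  have hRA : R ≤ S.map χ := fun r hr =>
    Subalgebra.mem_map.mpr ⟨ψ ⟨r, hr⟩, hψS ((AlgHom.mem_range ψ).mpr ⟨⟨r, hr⟩, rfl⟩), hψχ ⟨r, hr⟩⟩
  exact ⟨S.map χ, hAO, hRA, hSfg.map χ, isFractionRing_of_le hRA hRfr,
    isRegularLocalRing_centre_map_of_injective O L S hS χ hinj hloc hAO⟩

end Summit.ResolutionOfSingularities.ResolutionOfSingularities.Theorems.IndSmoothBirth

end
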